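import Literature.AlgebraicGeometry.Resolution.BlowupPrincipalCharts
import Literature.AlgebraicGeometry.Motives.ProjectiveOfGeneratingSections
import HarnessLib

/-!
# Generating sections on a blowing up: `π^*𝓛^{⊗(d+1)} ⊗ I·𝒪_{X'}` in chart form

Topic: `Literature/AlgebraicGeometry/Resolution`. The chart-form rendering of the key step of
Hartshorne II, Prop. 7.10 (b) / Prop. 7.16 (c) ("`π` is a projective morphism, and we can take
`𝒪_P(1) ⊗ π^*𝓛ⁿ` to be a very ample invertible sheaf"; Görtz–Wedhorn I, Prop. 13.96 (1):
"`𝓘𝒪_{X̃} = 𝒪_{X̃}(1)` is very ample for `π`") for a blowing up `π : X' → X` in the sense of the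
universal property (`IsBlowup π I`, `Blowups.lean`).

Data: generating-sections data `D` on `X` (`Literature.AlgebraicGeometry.Motives.GeneratingSections`:
the opens `U a = X_{s_a}` and ratios `s_b/s_a` of sections `s_a` generating an invertible sheaf
`𝓛`) with affine `U a`, and a family `G m` (`m ∈ M`) of global sections of `𝓛^{⊗d}` WITH VALUES IN
`I` (`(G m)_a ∈ I(U a)` in every chart), each with a home chart `h m`, such that the home values
`(G m)_{a}`, `h m = a`, generate `I(U a)`. Output (`BlowupSections.generatingSections`):
generating-sections data on `X'` indexed by `M` — that of the invertible sheaf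
`π^*𝓛^{⊗(d+1)} ⊗ I·𝒪_{X'}` with the generating sections `π^*(s_{h m} ⊗ G m)` — whose opens are the
principal charts `X'[U_{h m}, (G m)_{h m}]` (`BlowupPrincipalCharts.lean`), hence AFFINE
(`BlowupSections.isAffineOpen_generatingSections_U`). In the chart `m` (where `π^*𝓛` is trivialised by
`s_{h m}` and `I·𝒪_{X'}` by its regular generator `π^*(G m)_{h m}`) the ratio of the sections
`m'` and `m` is the regular function `(π^*(G m')_{a} / π^*(G m)_{a}) · π^*(s_{h m'}/s_{a})`,
`a = h m` (`BlowupSections.ratio`); the three axioms of generating-sections data (`ratio_self`,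
`basicOpen_ratio`, cocycle) are verified by cancelling the regular generator.

With `GeneratingSections.isProjectiveOver_of_isAffineOpen` (`Motives/ProjectiveOfGeneratingSections`:
a proper scheme over a field with finitely many generating sections with affine non-vanishing
loci is projective) this yields the projectivity of blowing ups of projective schemes
(`AlterationsBlowupDivisorProofs.lean`).

## Sources

* R. Hartshorne, *Algebraic Geometry*, GTM 52 (1977), II Prop. 7.10 (b) and its proof (p. 161),
  Prop. 7.16 (c) (p. 166). [Hartshorne1977]
* U. Görtz, T. Wedhorn, *Algebraic Geometry I*, 2nd ed. (2020), Prop. 13.96 (1), Summary 13.71,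
  Remark 13.73. [GortzWedhorn2020]
* The Stacks Project, Tag 0804 (charts of the blowing up), Tag 02NS. [StacksProject]
-/

noncomputable section

open CategoryTheory CategoryTheory.Limits AlgebraicGeometry TopologicalSpace Opposite
open Literature.AlgebraicGeometry.Motives Literature.AlgebraicGeometry.Motives.GeneratingSections

namespace Literature.AlgebraicGeometry.Resolution

universe u

variable {ι : Type} {X' X : Scheme.{u}} (D : GeneratingSections ι X) {I : X.IdealSheafData}
  {π : X' ⟶ X}

namespace BlowupSections

/-! ## Pulling back sections of the base along `π` -/

section Pullback

/-- Pull-back of a section over `U a` to an open `W ⊆ π⁻¹(U a)` of `X'`. [folklore] -/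
abbrev pb (a : ι) (W : X'.Opens) (hW : W ≤ π ⁻¹ᵁ D.U a) (s : Γ(X, D.U a)) : Γ(X', W) :=
  π.appLE (D.U a) W hW s

variable {D}

/-- Pulling back a restricted section. [folklore] -/
theorem pb_rs {a : ι} {V : X.Opens} (hV : V ≤ D.U a) (W : X'.Opens) (hW : W ≤ π ⁻¹ᵁ V)
    (s : Γ(X, D.U a)) :
    π.appLE V W hW (rs hV s) = pb D a W (hW.trans (π.preimage_mono hV)) s := by
  rw [rs, ← CommRingCat.comp_apply, Scheme.Hom.map_appLE]

/-- Restricting a pulled-back section (the analogue of `map_appLE_eq`, `BlowupPrincipalCharts.lean`,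
for the not necessarily affine opens `D.U a`). [folklore] -/
theorem rs_pb {a : ι} {W W' : X'.Opens} (hW : W ≤ π ⁻¹ᵁ D.U a) (h : W' ≤ W) (s : Γ(X, D.U a)) :
    rs h (pb D a W hW s) = pb D a W' (h.trans hW) s := by
  rw [rs, ← CommRingCat.comp_apply, Scheme.Hom.appLE_map]

/-- An open over both `U a` and `U b` lies over the overlap `V a b = X_{s_b/s_a}`. [folklore] -/
theorem le_preimage_V {a b : ι} {W : X'.Opens} (ha : W ≤ π ⁻¹ᵁ D.U a) (hb : W ≤ π ⁻¹ᵁ D.U b) :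
    W ≤ π ⁻¹ᵁ D.V a b := by
  rw [D.V_eq]
  exact le_inf ha hb

/-- **Transition rule of a section of `𝓛^{⊗d}` pulled back to `X'`**: over `U a ∩ U b`,
`π^*(t/s_b^d) = π^*(t/s_a^d) · π^*(s_a/s_b)^d`. [folklore] -/
theorem pb_val_eq {d : ℕ} (t : D.Sec d) {a b : ι} {W : X'.Opens} (ha : W ≤ π ⁻¹ᵁ D.U a)
    (hb : W ≤ π ⁻¹ᵁ D.U b) :
    pb D b W hb (t.val b) = pb D a W ha (t.val a) * pb D b W hb (D.ratio b a) ^ d := by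
  have hW := le_preimage_V ha hb
  have e := congrArg (π.appLE (D.V a b) W hW) (t.compat a b)
  rw [map_mul, map_pow, pb_rs, pb_rs, pb_rs] at e
  exact e

/-- `π^*(s_b/s_a) · π^*(s_a/s_b) = 1` over `U a ∩ U b`. [folklore] -/
theorem pb_ratio_mul_pb_ratio_symm {a b : ι} {W : X'.Opens} (ha : W ≤ π ⁻¹ᵁ D.U a)
    (hb : W ≤ π ⁻¹ᵁ D.U b) :
    pb D a W ha (D.ratio a b) * pb D b W hb (D.ratio b a) = 1 := by
  have hW := le_preimage_V ha hb
  have e := congrArg (π.appLE (D.V a b) W hW) (D.ratio_mul_ratio_symm a b)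
  rw [map_mul, map_one, pb_rs, pb_rs] at e
  exact e

/-- `π^*(s_b/s_a)` is a unit over `U a ∩ U b`. [folklore] -/
theorem isUnit_pb_ratio {a b : ι} {W : X'.Opens} (ha : W ≤ π ⁻¹ᵁ D.U a)
    (hb : W ≤ π ⁻¹ᵁ D.U b) : IsUnit (pb D a W ha (D.ratio a b)) :=
  IsUnit.of_mul_eq_one _ (pb_ratio_mul_pb_ratio_symm ha hb)

/-- **The cocycle rule pulled back**: `π^*(s_b/s_a) · π^*(s_c/s_b) = π^*(s_c/s_a)` over
`U a ∩ U b`. [folklore] -/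
theorem pb_ratio_mul_pb_ratio {a b : ι} (c : ι) {W : X'.Opens} (ha : W ≤ π ⁻¹ᵁ D.U a)
    (hb : W ≤ π ⁻¹ᵁ D.U b) :
    pb D a W ha (D.ratio a b) * pb D b W hb (D.ratio b c) = pb D a W ha (D.ratio a c) := by
  have hW := le_preimage_V ha hb
  have e := congrArg (π.appLE (D.V a b) W hW) (D.cocycle a b c)
  rw [map_mul, pb_rs, pb_rs, pb_rs] at e
  exact e

/-- The non-vanishing locus of `π^*(s_b/s_a)` on `W ⊆ π⁻¹(U a)` is `W ∩ π⁻¹(U b)`. [folklore] -/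
theorem basicOpen_pb_ratio {a : ι} (b : ι) {W : X'.Opens} (ha : W ≤ π ⁻¹ᵁ D.U a) :
    X'.basicOpen (pb D a W ha (D.ratio a b)) = W ⊓ π ⁻¹ᵁ D.U b := by
  rw [pb, Scheme.basicOpen_appLE, D.basicOpen_ratio]
  apply le_antisymm
  · exact le_inf inf_le_left (inf_le_right.trans (π.preimage_mono inf_le_right))
  · exact le_inf inf_le_left (le_inf (inf_le_left.trans ha) inf_le_right)

end Pullback

/-! ## Two generators of a principal ideal -/

section Algebra

/-- If `x` and `y` generate the same principal ideal and `x` is a nonzerodivisor, then `y = u·x`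
for a unit `u`. [folklore] -/
theorem exists_isUnit_of_span_eq {A : Type*} [CommRing A] {x y : A} (hx : x ∈ nonZeroDivisors A)
    (h : Ideal.span {x} = Ideal.span {y}) : ∃ u : A, IsUnit u ∧ y = u * x := by
  obtain ⟨e, he⟩ := Ideal.mem_span_singleton'.mp (h ▸ Ideal.mem_span_singleton_self y : y ∈ Ideal.span {x})
  obtain ⟨f, hf⟩ := Ideal.mem_span_singleton'.mp (h.symm ▸ Ideal.mem_span_singleton_self x : x ∈ Ideal.span {y})
  refine ⟨e, ?_, he.symm⟩
  have h1 : (f * e - 1) * x = 0 := by rw [sub_mul, mul_assoc, he, hf, one_mul, sub_self]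
  have h2 : f * e = 1 := sub_eq_zero.mp (mem_nonZeroDivisors_iff_right.mp hx _ h1)
  exact IsUnit.of_mul_eq_one_right f h2

end Algebra

end BlowupSections

/-! ## The data: `I`-valued sections of `𝓛^{⊗d}` on the base of a blowing up -/

/-- **`I`-valued sections data for a blowing up `π : X' → X` along `I`**, relative to
generating-sections data `D` (sections `s_a` of an invertible sheaf `𝓛`, charts `U a = X_{s_a}`)
on `X` with affine charts: a family `sec m`, `m ∈ M`, of global sections of `𝓛^{⊗deg}` with
values in `I` (`(sec m)_a ∈ I(U a)` for all `a`), each with a home chart `home m`, such that for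
every `a` the home values `(sec m)_a`, `home m = a`, generate `I(U a)` — i.e. finitely many global
sections of `I ⊗ 𝓛^{⊗deg}` generating it, as in Hartshorne II, proof of Prop. 7.10 (b) ("we can
find a finite number of global sections which generate `𝓢₁ ⊗ 𝓛ⁿ`"). [cite: Hartshorne1977, II Prop. 7.10 (b) (proof)] -/
structure BlowupSections (D : GeneratingSections ι X) (I : X.IdealSheafData) (π : X' ⟶ X)
    (M : Type) where
  /-- the charts `U a` of the base are affine -/
  affine : ∀ a, IsAffineOpen (D.U a)
  /-- `π` is a blowing up of `X` along `I` -/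
  isBlowup : IsBlowup π I
  /-- the home chart of the section `m` -/
  home : M → ι
  /-- the common degree of the sections -/
  deg : ℕ
  /-- the sections of `𝓛^{⊗deg}` in chart form -/
  sec : M → D.Sec deg
  /-- the sections take values in `I` -/
  sec_mem : ∀ m a, (sec m).val a ∈ I.ideal ⟨D.U a, affine a⟩
  /-- over `U a` the home values `(sec m)_a`, `home m = a`, generate `I(U a)` -/
  span_eq : ∀ a, Ideal.span (Set.range fun m : {m // home m = a} => (sec m.1).val a) =
    I.ideal ⟨D.U a, affine a⟩

namespace BlowupSections

variable {D} {M : Type} (S : BlowupSections D I π M)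

/-! ## The charts and the sections -/

section Data

/-- The affine open `U a` of the base. [folklore] -/
abbrev base (a : ι) : X.affineOpens := ⟨D.U a, S.affine a⟩

/-- **The chart of the section `m`**: the principal chart `X'[U_{h m}, (G m)_{h m}]` of `π`
(`h = home`, `G = sec`) — the non-vanishing locus of the section `π^*(s_{h m} ⊗ G m)` of
`π^*𝓛^{⊗(d+1)} ⊗ I·𝒪_{X'}`. [cite: Hartshorne1977, II Prop. 7.10 (b) (proof)] -/
def chart (m : M) : X'.Opens :=
  blowupChart π I (S.base (S.home m)) ((S.sec m).val (S.home m))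

/-- The chart of `m` lies over its home chart `U (h m)`. [folklore] -/
theorem chart_le (m : M) : S.chart m ≤ π ⁻¹ᵁ D.U (S.home m) :=
  blowupChart_le_preimage _ _ _ _

/-- **The charts are affine.** [cite: StacksProject, Tag 0804] -/
theorem isAffineOpen_chart (m : M) : IsAffineOpen (S.chart m) :=
  S.isBlowup.isAffineOpen_blowupChart (S.sec_mem m (S.home m))

/-- The chart of `m` as an affine open. [folklore] -/
def chartAff (m : M) : X'.affineOpens :=
  ⟨S.chart m, S.isAffineOpen_chart m⟩

/-- The chart of `m` is a principal chart for `(U_{h m}, (G m)_{h m})`. [folklore] -/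
theorem isPrincipalChart_chart (m : M) :
    IsPrincipalChart π I (S.base (S.home m)) ((S.sec m).val (S.home m)) (S.chartAff m) :=
  S.isBlowup.isPrincipalChart_blowupChart (S.sec_mem m (S.home m))

/-- **The regular generator** `π^*(G m)_{h m}` of `I·𝒪_{X'}` on the chart of `m` (the
trivialisation of `I·𝒪_{X'}` there). [cite: StacksProject, Tag 0804] -/
def gen (m : M) : Γ(X', S.chart m) :=
  pb D (S.home m) _ (S.chart_le m) ((S.sec m).val (S.home m))

/-- The pull-back `π^*(G m')_{h m}` of the home-chart-`m` value of the section `m'`. [folklore] -/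
def num (m m' : M) : Γ(X', S.chart m) :=
  pb D (S.home m) _ (S.chart_le m) ((S.sec m').val (S.home m))

/-- The generator is regular. [cite: StacksProject, Tag 0804] -/
theorem gen_mem_nonZeroDivisors (m : M) : S.gen m ∈ nonZeroDivisors Γ(X', S.chart m) :=
  (S.isPrincipalChart_chart m).2.1

/-- On the chart of `m`, `I·𝒪_{X'}` is generated by `π^*(G m)_{h m}`.
[cite: StacksProject, Tag 0804] -/
theorem ideal_chart (m : M) : (I.comap π).ideal (S.chartAff m) = Ideal.span {S.gen m} :=
  (S.isPrincipalChart_chart m).2.2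

/-- `π^*(G m')_{h m}` is a multiple of the generator on the chart of `m`. [folklore] -/
theorem exists_num_eq_mul (m m' : M) : ∃ c : Γ(X', S.chart m), S.num m m' = c * S.gen m :=
  (S.isPrincipalChart_chart m).exists_eq_mul (S.sec_mem m' (S.home m))

/-- **The quotient `π^*(G m')_{a} / π^*(G m)_{a}`** (`a = h m`) on the chart of `m`: the unique
regular function `c` with `π^*(G m')_a = c · π^*(G m)_a`. [folklore] -/
def quot (m m' : M) : Γ(X', S.chart m) :=
  (S.exists_num_eq_mul m m').choose

/-- The defining equation of the quotient. [folklore] -/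
theorem num_eq (m m' : M) : S.num m m' = S.quot m m' * S.gen m :=
  (S.exists_num_eq_mul m m').choose_spec

/-- **The ratio of the sections `m'` and `m`** on the chart of `m`:
`(π^*(G m')_a / π^*(G m)_a) · π^*(s_{h m'}/s_a)`, `a = h m` — the ratio of the sections
`π^*(s_{h m'} ⊗ G m')` and `π^*(s_a ⊗ G m)` of `π^*𝓛^{⊗(d+1)} ⊗ I·𝒪_{X'}` in the trivialisation
of the chart of `m`. [cite: Hartshorne1977, II Prop. 7.10 (b) (proof)] -/
def ratio (m m' : M) : Γ(X', S.chart m) :=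
  S.quot m m' * pb D (S.home m) _ (S.chart_le m) (D.ratio (S.home m) (S.home m'))

/-- The quotient of a section by itself is `1`. [folklore] -/
theorem quot_self (m : M) : S.quot m m = 1 := by
  apply (mul_cancel_right_mem_nonZeroDivisors (S.gen_mem_nonZeroDivisors m)).mp
  rw [one_mul, ← num_eq]
  rfl

/-- `ratio m m = 1`. [folklore] -/
theorem ratio_self (m : M) : S.ratio m m = 1 := by
  rw [ratio, quot_self, D.ratio_self, one_mul]
  exact map_one (π.appLE _ _ _).hom

end Data

/-! ## The non-vanishing locus of a ratio -/

section BasicOpen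

/-- On an open `W` of the chart of `m` over `U (h m')`, the pull-back `π^*(G m')_{h m'}` is the
quotient times a unit times the restricted generator. [folklore] -/
theorem pb_val_home_eq (m m' : M) {W : X'.Opens} (hWm : W ≤ S.chart m)
    (hWb : W ≤ π ⁻¹ᵁ D.U (S.home m')) :
    pb D (S.home m') W hWb ((S.sec m').val (S.home m')) =
      (rs hWm (S.quot m m') * pb D (S.home m') W hWb (D.ratio (S.home m') (S.home m)) ^ S.deg) *
        rs hWm (S.gen m) := by
  have hWa : W ≤ π ⁻¹ᵁ D.U (S.home m) := hWm.trans (S.chart_le m)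
  rw [pb_val_eq (S.sec m') hWa hWb]
  have e := congrArg (rs hWm) (S.num_eq m m')
  rw [map_mul, num, rs_pb] at e
  rw [e, gen, rs_pb]
  ring

/-- **The non-vanishing locus of `ratio m m'` is the intersection of the charts of `m` and `m'`.**
(`⊆`: on the basic open of the ratio inside the chart of `m`, `π^*(G m')_{h m'}` is a unit multiple
of the regular generator, so it is a principal chart for `m'`; `⊇`: on a common principal chart
both `π^*(G m)_{h m}` and `π^*(G m')_{h m'}` are regular generators, so the quotient is a unit.)
[cite: Hartshorne1977, II Prop. 7.10 (b) (proof)] -/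
theorem basicOpen_ratio (m m' : M) : X'.basicOpen (S.ratio m m') = S.chart m ⊓ S.chart m' := by
  -- notation
  have hVm := S.chart_le m
  have hPm := S.isPrincipalChart_chart m
  apply le_antisymm
  · -- `⊆`
    intro x hx
    have hx' := hx
    rw [ratio, Scheme.basicOpen_mul] at hx'
    obtain ⟨hxq, hxt⟩ := hx'
    have hxm : x ∈ S.chart m := X'.basicOpen_le _ hxq
    refine ⟨hxm, ?_⟩
    -- the affine open `W = X'_{ratio m m'}` is a principal chart for `m'`
    let W : X'.affineOpens := X'.affineBasicOpen (U := S.chartAff m) (S.ratio m m')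
    have hWm : (W : X'.Opens) ≤ S.chart m := X'.basicOpen_le _
    have hWqt : ∀ y, y ∈ (W : X'.Opens) → y ∈ X'.basicOpen (S.quot m m') ∧
        y ∈ X'.basicOpen (pb D (S.home m) _ hVm (D.ratio (S.home m) (S.home m'))) := by
      intro y hy
      change y ∈ X'.basicOpen (S.ratio m m') at hy
      rw [ratio, Scheme.basicOpen_mul] at hy
      exact hy
    have hWb : (W : X'.Opens) ≤ π ⁻¹ᵁ D.U (S.home m') := by
      intro y hy
      have hy' := (hWqt y hy).2
      rw [basicOpen_pb_ratio] at hy'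
      exact hy'.2
    have hWq : (W : X'.Opens) ≤ X'.basicOpen (S.quot m m') := fun y hy => (hWqt y hy).1
    have hP : IsPrincipalChart π I (S.base (S.home m')) ((S.sec m').val (S.home m')) W := by
      obtain ⟨_, hnzd, hideal⟩ := hPm.of_le hWm
      -- the generator for `m'` is a unit multiple of the restricted generator for `m`
      have hunit : IsUnit (rs hWm (S.quot m m') *
          pb D (S.home m') W hWb (D.ratio (S.home m') (S.home m)) ^ S.deg) :=
        (isUnit_rs_of_le_basicOpen _ hWq).mul ((isUnit_pb_ratio hWb (hWm.trans hVm)).pow S.deg)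
      have key := S.pb_val_home_eq m m' hWm hWb
      rw [pb, gen, rs_pb] at key
      refine ⟨hWb, ?_, ?_⟩
      · rw [key]
        exact mul_mem_nonZeroDivisors.mpr ⟨hunit.mem_nonZeroDivisors, hnzd⟩
      · rw [key, Ideal.span_singleton_mul_left_unit hunit]
        exact hideal
    exact hP.le_blowupChart hx
  · -- `⊇`
    rintro x ⟨hxm, hxm'⟩
    obtain ⟨W, hW', hxW, hWm⟩ := exists_isPrincipalChart_le_of_mem hxm' hxm
    have hWb : (W : X'.Opens) ≤ π ⁻¹ᵁ D.U (S.home m') := hW'.le_preimage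
    -- two regular generators of `(I·𝒪_{X'})(W)`
    obtain ⟨_, hnzd, hideal⟩ := hPm.of_le hWm
    obtain ⟨_, hnzd', hideal'⟩ := hW'
    have key := S.pb_val_home_eq m m' hWm hWb
    rw [pb, gen, rs_pb] at key
    obtain ⟨v, hv, hv'⟩ := exists_isUnit_of_span_eq hnzd (hideal.symm.trans hideal')
    rw [key] at hv'
    have hqu : IsUnit (rs hWm (S.quot m m')) := by
      have e := (mul_cancel_right_mem_nonZeroDivisors hnzd).mp hv'
      have : IsUnit (rs hWm (S.quot m m') *
          pb D (S.home m') W hWb (D.ratio (S.home m') (S.home m)) ^ S.deg) := e ▸ hv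
      exact isUnit_of_mul_isUnit_left this
    -- hence `x ∈ X'_{quot} ∩ X'_{twist}`
    rw [ratio, Scheme.basicOpen_mul]
    constructor
    · have e : X'.basicOpen (rs hWm (S.quot m m')) = (W : X'.Opens) := X'.basicOpen_of_isUnit hqu
      rw [basicOpen_rs] at e
      exact (e.symm.le hxW).2
    · rw [basicOpen_pb_ratio]
      exact ⟨hxm, hWb hxW⟩

end BasicOpen

/-! ## The cocycle rule -/

section Cocycle

/-- **The cocycle rule** `ratio m m' · ratio m' m'' = ratio m m''` on the intersection of the
charts of `m` and `m'` (multiply by the regular generator `π^*(G m)_{h m}` and use the transition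
rules of the `G`'s and of the `s`'s). [cite: Hartshorne1977, II Prop. 7.10 (b) (proof)] -/
theorem ratio_mul_ratio (m m' m'' : M) :
    X'.presheaf.map (homOfLE inf_le_left).op (S.ratio m m') *
        X'.presheaf.map (homOfLE inf_le_right).op (S.ratio m' m'') =
      X'.presheaf.map (homOfLE (inf_le_left : S.chart m ⊓ S.chart m' ≤ S.chart m)).op
        (S.ratio m m'') := by
  -- notation: everything on `W = chart m ∩ chart m'`
  have h₁ : S.chart m ⊓ S.chart m' ≤ S.chart m := inf_le_left
  have h₂ : S.chart m ⊓ S.chart m' ≤ S.chart m' := inf_le_right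
  have ha : S.chart m ⊓ S.chart m' ≤ π ⁻¹ᵁ D.U (S.home m) := h₁.trans (S.chart_le m)
  have hb : S.chart m ⊓ S.chart m' ≤ π ⁻¹ᵁ D.U (S.home m') := h₂.trans (S.chart_le m')
  change rs h₁ (S.ratio m m') * rs h₂ (S.ratio m' m'') = rs h₁ (S.ratio m m'')
  -- the regular generator `N = π^*(G m)_a` on `W`
  have hNreg : pb D (S.home m) _ ha ((S.sec m).val (S.home m)) ∈ nonZeroDivisors _ := by
    have := map_mem_nonZeroDivisors_of_le_affine (U := S.chartAff m) h₁ (S.gen_mem_nonZeroDivisors m)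
    rw [gen] at this
    change rs h₁ (pb D (S.home m) _ _ ((S.sec m).val (S.home m))) ∈ _ at this
    rwa [rs_pb] at this
  -- the relations
  have e1 : pb D (S.home m) _ ha ((S.sec m').val (S.home m)) =
      rs h₁ (S.quot m m') * pb D (S.home m) _ ha ((S.sec m).val (S.home m)) := by
    have e := congrArg (rs h₁) (S.num_eq m m')
    rw [map_mul, num, rs_pb, gen, rs_pb] at e
    exact e
  have e2 : pb D (S.home m) _ ha ((S.sec m'').val (S.home m)) =
      rs h₁ (S.quot m m'') * pb D (S.home m) _ ha ((S.sec m).val (S.home m)) := by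
    have e := congrArg (rs h₁) (S.num_eq m m'')
    rw [map_mul, num, rs_pb, gen, rs_pb] at e
    exact e
  have e3 : pb D (S.home m') _ hb ((S.sec m'').val (S.home m')) =
      rs h₂ (S.quot m' m'') * pb D (S.home m') _ hb ((S.sec m').val (S.home m')) := by
    have e := congrArg (rs h₂) (S.num_eq m' m'')
    rw [map_mul, num, rs_pb, gen, rs_pb] at e
    exact e
  have e4 := pb_val_eq (S.sec m') ha hb
  have e5 := pb_val_eq (S.sec m'') ha hb
  have e6 : pb D (S.home m) _ ha (D.ratio (S.home m) (S.home m')) *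
      pb D (S.home m') _ hb (D.ratio (S.home m') (S.home m)) = 1 :=
    pb_ratio_mul_pb_ratio_symm ha hb
  have e7 := pb_ratio_mul_pb_ratio (D := D) (S.home m'') ha hb
  -- expand the three ratios
  rw [ratio, ratio, ratio, map_mul, map_mul, map_mul, rs_pb, rs_pb, rs_pb]
  -- generalize
  set N := pb D (S.home m) _ ha ((S.sec m).val (S.home m))
  set q₁' := rs h₁ (S.quot m m')
  set q₁'' := rs h₁ (S.quot m m'')
  set q₂'' := rs h₂ (S.quot m' m'')
  set A' := pb D (S.home m) _ ha ((S.sec m').val (S.home m))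
  set A'' := pb D (S.home m) _ ha ((S.sec m'').val (S.home m))
  set B' := pb D (S.home m') _ hb ((S.sec m').val (S.home m'))
  set B'' := pb D (S.home m') _ hb ((S.sec m'').val (S.home m'))
  set Aab := pb D (S.home m) _ ha (D.ratio (S.home m) (S.home m'))
  set Aac := pb D (S.home m) _ ha (D.ratio (S.home m) (S.home m''))
  set Bba := pb D (S.home m') _ hb (D.ratio (S.home m') (S.home m))
  set Bbc := pb D (S.home m') _ hb (D.ratio (S.home m') (S.home m''))
  have e6' : Aab ^ S.deg * Bba ^ S.deg = 1 := by rw [← mul_pow, e6, one_pow]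
  -- cancel `N`
  apply (mul_cancel_right_mem_nonZeroDivisors hNreg).mp
  calc q₁' * Aab * (q₂'' * Bbc) * N = (q₁' * N) * Aab * q₂'' * Bbc := by ring
    _ = A' * (Aab ^ S.deg * Bba ^ S.deg) * Aab * q₂'' * Bbc := by rw [← e1, e6', mul_one]
    _ = (A' * Bba ^ S.deg) * Aab ^ S.deg * Aab * q₂'' * Bbc := by ring
    _ = (q₂'' * B') * Aab ^ S.deg * Aab * Bbc := by rw [← e4]; ring
    _ = A'' * (Aab ^ S.deg * Bba ^ S.deg) * (Aab * Bbc) := by rw [← e3, e5]; ring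
    _ = q₁'' * Aac * N := by rw [e6', e7, e2]; ring

end Cocycle

/-! ## The generating-sections data on `X'` -/

section Main

/-- **The charts cover `X'`**: over each `U a` the principal charts at the generators
`(G m)_a`, `h m = a`, of `I(U a)` cover `π⁻¹(U a)` (`IsBlowup.iSup_blowupChart`), and the `U a`
cover `X`. [cite: StacksProject, Tag 0804] -/
theorem iSup_chart : ⨆ m, S.chart m = ⊤ := by
  refine top_le_iff.mp ?_
  have hX : (⊤ : X'.Opens) = ⨆ a, π ⁻¹ᵁ D.U a := by
    rw [← Scheme.Hom.preimage_iSup, D.iSup_U]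
    rfl
  rw [hX]
  refine iSup_le fun a => ?_
  rw [← S.isBlowup.iSup_blowupChart (U := S.base a) _ (S.span_eq a)]
  refine iSup_le fun m => ?_
  obtain ⟨m, rfl⟩ := m
  exact le_iSup (fun m => S.chart m) m

/-- **Generating-sections data on the blowing up** (Hartshorne II, proof of Prop. 7.10 (b), in
chart form): the opens are the principal charts `X'[U_{h m}, (G m)_{h m}]` — the non-vanishing
loci of the sections `π^*(s_{h m} ⊗ G m)` of the invertible sheaf `π^*𝓛^{⊗(d+1)} ⊗ I·𝒪_{X'}` —
and the ratios are `BlowupSections.ratio`. [cite: Hartshorne1977, II Prop. 7.10 (b) and Prop. 7.16 (c)] -/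
def generatingSections : GeneratingSections M X' where
  U := S.chart
  iSup_U := S.iSup_chart
  ratio := S.ratio
  ratio_self := S.ratio_self
  basicOpen_ratio := S.basicOpen_ratio
  ratio_mul_ratio := S.ratio_mul_ratio

/-- The opens of the data are the charts. [folklore] -/
@[simp] theorem generatingSections_U (m : M) : S.generatingSections.U m = S.chart m := rfl

/-- **The opens of the generating-sections data on the blowing up are affine** (they are the
charts `Spec A[I/g]`, Stacks 0804) — the hypothesis of
`GeneratingSections.isProjectiveOver_of_isAffineOpen`. [cite: StacksProject, Tag 0804] -/
theorem isAffineOpen_generatingSections_U (m : M) : IsAffineOpen (S.generatingSections.U m) :=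
  S.isAffineOpen_chart m

end Main

end BlowupSections

end Literature.AlgebraicGeometry.Resolution

end
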